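import Summits.ValiantsHypothesis.ValiantsHypothesis.Theorems.DivisionGapPerDivisionHardStubFaceDescent

/-!
# Crux `DivisionGap.PerDivisionHard` (stmt-ValiantsHypothesis-5065), line
`pair-descent-jss-endpoint` — stub `stub_erasedDescent` (face descent with erasure)

For cell sets `G, D ⊆ [n] × [n]`, a weight `w` cutting out the face `G` of the Birkhoff polytope
(`CutsOut w G`), a nonzero cofactor `h ∈ ℝ≥0[x_ij]` and an exponent vector `u` such that every
monomial of the top-`w` fibre of `h` agrees with `u` on the cells of `G` OUTSIDE `D`:

  `L(x^{u'} · per_G|_{x_e = 1 (e ∈ D)}) ≤ L(per_n · h) + 1`,  `u' = u|_{G ∖ D}`,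

`L = complexity` over the semiring `ℝ≥0`.  The case `D = ∅` is the landed `stub_faceDescent`
(`Theorems/DivisionGapPerDivisionHardStubFaceDescent.lean`), which is the template of this file.

Proof (three free moves and one gate).
1. `top_w(per_n · h) = per_G · top_w h` is free (`complexity_topComponent_le`, `topComponent_mul`,
   `topComponent_perPoly_eq_facePer`): `L(per_G · top_w h) ≤ L(per_n · h)`.
2. The substitution `x_e ↦ x_e` for `e ∈ G ∖ D`, `x_e ↦ 1` otherwise, is a projection, hence
   free (`complexity_le_of_isProjection`).  On `per_G`, all of whose variables lie in `G`, it is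
   the erasure `x_e ↦ 1 (e ∈ D)`; and it maps `top_w h` to `a · x^{u'}` with
   `a = Σ coeff (top_w h) ≠ 0` (`h ≠ 0`), since every fibre monomial agrees with `u'` on `G ∖ D`.
3. Unscale by `a⁻¹` at the cost of one gate (`complexity_smul_le_holds`).
-/

noncomputable section

-- `Summit.ValiantsHypothesis.ValiantsHypothesis.…` is the tree's mandated single-conjunct layout
-- (Sub = Summit), so the duplicated namespace component is intended.
set_option linter.dupNamespace false

namespace Summit.ValiantsHypothesis.ValiantsHypothesis.Theorems.DivisionGapPerDivisionHard

open MvPolynomial Literature.Computability.AlgebraicComplexity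
open Summit.ValiantsHypothesis.ValiantsHypothesis.Theorems.ZeroOneTransfer.Negative
open scoped NNReal

variable {n : ℕ}

/-! ### The projection keeping the cells of a set `S`

It is the substitution `fun e => if e ∈ S then X e else 1` (written inline throughout). -/

/-- Keeping the variables of the cells of `S` and sending the others to `1` is a projection
(every value is a variable or the constant `1`). [folklore] -/
private theorem isProjection_keepOnly (S : Finset (Fin n × Fin n))
    (p : MvPolynomial (Fin n × Fin n) ℝ≥0) :
    IsProjection (aeval (fun e : Fin n × Fin n =>
      if e ∈ S then X e else (1 : MvPolynomial (Fin n × Fin n) ℝ≥0)) p) p := by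
  refine ⟨_, fun e => ?_, rfl⟩
  by_cases he : e ∈ S
  · left; exact ⟨e, by simp [he]⟩
  · right; exact ⟨1, by simp [he]⟩

/-- On the face permanent `per_G`, all of whose variables lie in `G`, keeping the cells of `G \ D`
is erasing the cells of `D`. [folklore] -/
private theorem aeval_keepOnly_sdiff_facePer (G D : Finset (Fin n × Fin n)) :
    aeval (fun e : Fin n × Fin n =>
        if e ∈ G \ D then X e else (1 : MvPolynomial (Fin n × Fin n) ℝ≥0)) (facePer G) =
      aeval (fun e : Fin n × Fin n =>
        if e ∈ D then (1 : MvPolynomial (Fin n × Fin n) ℝ≥0) else X e) (facePer G) := by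
  unfold facePer
  rw [map_sum, map_sum]
  refine Finset.sum_congr rfl fun σ hσ => ?_
  have hσG : ∀ i, (σ i, i) ∈ G := (Finset.mem_filter.mp hσ).2
  rw [show (monomial (permMonomial σ) (1 : ℝ≥0) : MvPolynomial _ ℝ≥0) = ∏ i, X (σ i, i) by
    rw [permMonomial, monomial_sum_one]; rfl]
  rw [map_prod, map_prod]
  refine Finset.prod_congr rfl fun i _ => ?_
  rw [aeval_X, aeval_X]
  by_cases hD : (σ i, i) ∈ D
  · have h1 : (σ i, i) ∉ G \ D := fun h => (Finset.mem_sdiff.mp h).2 hD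
    simp only [if_pos hD, if_neg h1]
  · have h1 : (σ i, i) ∈ G \ D := Finset.mem_sdiff.mpr ⟨hσG i, hD⟩
    simp only [if_neg hD, if_pos h1]

/-- Keeping the cells of `S`, a monomial agreeing with `u` on `S` (`u` supported inside `S`)
becomes `x^u`. [folklore] -/
private theorem prod_keepOnly_eq_monomial (S : Finset (Fin n × Fin n))
    {u m : (Fin n × Fin n) →₀ ℕ} (huS : u.support ⊆ S) (hmu : ∀ e ∈ S, m e = u e) :
    (m.prod fun e k =>
        (if e ∈ S then X e else (1 : MvPolynomial (Fin n × Fin n) ℝ≥0)) ^ k) =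
      monomial u 1 := by
  rw [Finsupp.prod]
  calc ∏ e ∈ m.support, (if e ∈ S then X e else (1 : MvPolynomial (Fin n × Fin n) ℝ≥0)) ^ m e
      = ∏ e ∈ m.support, (if e ∈ S then X e ^ u e else 1) := by
        refine Finset.prod_congr rfl fun e _ => ?_
        by_cases he : e ∈ S
        · simp only [if_pos he, hmu e he]
        · simp only [if_neg he, one_pow]
    _ = ∏ e ∈ m.support.filter (· ∈ S), X e ^ u e := (Finset.prod_filter _ _).symm
    _ = ∏ e ∈ u.support, X e ^ u e := by
        congr 1
        ext e
        simp only [Finset.mem_filter, Finsupp.mem_support_iff]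
        constructor
        · rintro ⟨hme, he⟩
          rwa [← hmu e he]
        · intro hue
          have he : e ∈ S := huS (Finsupp.mem_support_iff.mpr hue)
          exact ⟨by rwa [hmu e he], he⟩
    _ = monomial u 1 := prod_X_pow_eq_monomial

/-- Keeping the cells of `S`, a polynomial all of whose monomials agree with `u` on `S` (`u`
supported inside `S`) becomes `a · x^u`, `a` the sum of its coefficients. [folklore] -/
private theorem aeval_keepOnly_eq_monomial (S : Finset (Fin n × Fin n))
    {p : MvPolynomial (Fin n × Fin n) ℝ≥0} {u : (Fin n × Fin n) →₀ ℕ}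
    (huS : u.support ⊆ S) (hp : ∀ m ∈ p.support, ∀ e ∈ S, m e = u e) :
    aeval (fun e : Fin n × Fin n =>
        if e ∈ S then X e else (1 : MvPolynomial (Fin n × Fin n) ℝ≥0)) p =
      monomial u (∑ d ∈ p.support, coeff d p) := by
  conv_lhs => rw [p.as_sum]
  rw [map_sum, map_sum]
  refine Finset.sum_congr rfl fun d hd => ?_
  rw [aeval_monomial, prod_keepOnly_eq_monomial S huS (hp d hd), ← C_eq_algebraMap,
    C_mul_monomial, mul_one]

/-! ### The lever with erasure -/

/-- **`stub_erasedDescent` (face descent with erasure, line `pair-descent-jss-endpoint`).**  If `w`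
cuts out `G`, `h ≠ 0`, and the monomials of the top-`w` fibre of `h` agree with `u` on the cells
of `G` outside `D`, then for `u' = u|_{G ∖ D}`,
`L(x^{u'} · per_G|_{x_e = 1 (e ∈ D)}) ≤ L(per_n · h) + 1` over `ℝ≥0`:
`top_w(per_n · h) = per_G · top_w h` is free (`complexity_topComponent_le`, `topComponent_mul`,
`topComponent_perPoly_eq_facePer`), the projection keeping the cells of `G ∖ D` is free
(`complexity_le_of_isProjection`), erases `D` on `per_G` and leaves `a · x^{u'}` of the fibre
with `a ≠ 0`, and unscaling by `a⁻¹` costs one gate (`complexity_smul_le_holds`).  The case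
`D = ∅` is `stub_faceDescent`. [folklore] -/
theorem stub_erasedDescent :
    ∀ (n : ℕ) (G D : Finset (Fin n × Fin n)) (w : Fin n × Fin n → ℕ)
      (h : MvPolynomial (Fin n × Fin n) ℝ≥0) (u : (Fin n × Fin n) →₀ ℕ),
      CutsOut w G → h ≠ 0 →
      (∀ m ∈ (topComponent w h).support, ∀ e ∈ G, e ∉ D → m e = u e) →
      ∃ u' : (Fin n × Fin n) →₀ ℕ,
        complexity (monomial u' (1 : ℝ≥0) *
            aeval (fun e : Fin n × Fin n =>
              if e ∈ D then (1 : MvPolynomial (Fin n × Fin n) ℝ≥0) else X e) (facePer G)) ≤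
          complexity (perPoly (Fin n) ℝ≥0 * h) + 1 := by
  intro n G D w h u hcut hh hu
  set hs := topComponent w h with hhs
  have hne : hs ≠ 0 := topComponent_ne_zero _ hh
  -- (1) initial form
  have h1 : complexity (facePer G * hs) ≤ complexity (perPoly (Fin n) ℝ≥0 * h) := by
    have := complexity_topComponent_le w (perPoly (Fin n) ℝ≥0 * h)
    rwa [topComponent_mul, topComponent_perPoly_eq_facePer hcut] at this
  -- the restriction `u'` of `u` to `G \ D`
  set u' : (Fin n × Fin n) →₀ ℕ := u.filter (fun e => e ∈ G \ D) with hu'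
  have hu'S : u'.support ⊆ G \ D := by
    intro e he
    rw [hu', Finsupp.support_filter, Finset.mem_filter] at he
    exact he.2
  have hmu' : ∀ m ∈ hs.support, ∀ e ∈ G \ D, m e = u' e := by
    intro m hm e he
    rw [hu', Finsupp.filter_apply_pos _ _ he]
    exact hu m hm e (Finset.mem_sdiff.mp he).1 (Finset.mem_sdiff.mp he).2
  refine ⟨u', ?_⟩
  -- (2) projection
  set a : ℝ≥0 := ∑ d ∈ hs.support, coeff d hs with ha
  have ha0 : a ≠ 0 := sum_coeff_ne_zero hne
  have h2 : complexity (aeval (fun e : Fin n × Fin n =>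
        if e ∈ D then (1 : MvPolynomial (Fin n × Fin n) ℝ≥0) else X e) (facePer G) *
      monomial u' a) ≤ complexity (facePer G * hs) := by
    have := complexity_le_of_isProjection (isProjection_keepOnly (G \ D) (facePer G * hs))
    rwa [map_mul, aeval_keepOnly_sdiff_facePer, aeval_keepOnly_eq_monomial (G \ D) hu'S hmu']
      at this
  set F := aeval (fun e : Fin n × Fin n =>
    if e ∈ D then (1 : MvPolynomial (Fin n × Fin n) ℝ≥0) else X e) (facePer G) with hF
  -- (3) unscale
  have h3 : complexity (monomial u' (1 : ℝ≥0) * F) ≤ complexity (F * monomial u' a) + 1 := by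
    have heq : monomial u' (1 : ℝ≥0) * F = a⁻¹ • (F * monomial u' a) := by
      rw [mul_comm, ← mul_smul_comm, smul_monomial, smul_eq_mul, inv_mul_cancel₀ ha0]
    rw [heq]
    exact complexity_smul_le_holds _ _
  calc complexity (monomial u' (1 : ℝ≥0) * F)
      ≤ complexity (F * monomial u' a) + 1 := h3
    _ ≤ complexity (facePer G * hs) + 1 := Nat.succ_le_succ h2
    _ ≤ complexity (perPoly (Fin n) ℝ≥0 * h) + 1 := Nat.succ_le_succ h1

end Summit.ValiantsHypothesis.ValiantsHypothesis.Theorems.DivisionGapPerDivisionHard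

end
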